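import Summits.BirchSwinnertonDyer.BirchSwinnertonDyer.Theorems.ByReductionTypeAtTwoFineSelmerConjAAtTwoAdditivePotGoodAscentStampsA
import HarnessLib

/-!
# C4″ `AdditivePotMultOverKAtTwo` (item stmt-BirchSwinnertonDyer-22618), the (I1M′) input of the upper half on the `Δ < 0` rows:
# KERNEL STAMPS, part B — Iwasawa's `μ₂ = 0` (ZERO hypotheses) for the `2`-torsion cubic fields `d = -59`, `d = -200` and UNCONDITIONAL
# statement (A) at `2` for the C4″ census curves 365328bn1, 305200by1, 59200dz1

Cell `bsd-2adic`, rung K4, seat `bsd-2adic-k4-w3` GEN 11 (explicit unit of director-bsd g16 (309)(7); `--supports stmt-BirchSwinnertonDyer-22618`).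
HONEST FRAMING (D-0036/D-0054/D-0152): THEOREMS ONLY (no definition, no named fact, no `sorry`). FIELD PART (unconditional kernel arithmetic about an
explicit cubic field `ℚ(θ)`, polredabs cubic of eng-2's LAYERS table, `[𝓞 : ℤ[θ]] = 1`): `irreducible_cubic_<d>` (no root mod a small prime),
`odd_classNumber_of_root_<d>` (norm certificate below the Minkowski bound; k4-w1's `odd_classNumber_of_cubeCertificate` / `pow_three_eq_span_of_cert`),
**`classicalMu_two_cubicField_<d>`** = `μ = 0` (growth form) along EVERY cyclotomic `ℤ₂`-extension of `ℚ(θ)` from `e₀ = 0` (odd `h`), `e₁ = 0` (k4-w1's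
Chevalley door at `2`, `layerOneBit_of_chevalleyCert`: a unit with `2`-adic image `≡ ±3 (mod 8)` is not a norm from `ℚ(θ, √2)`; at most two primes above `2`),
`n₀ = 0` (odd cubic discriminant, `classicalMuVanishes_two_adjoin_of_odd_cubic_discr`; or `2 = 𝔭𝔮²` with an even-index certificate `u, v, m, m'`,
`classicalMuVanishes_two_adjoin_of_evenIndexCertificate`) and Fukuda 1994 Thm. 1 (1) (`_holds`, kernel). These fields have TWO primes above `2` (the
`2`-division cubic of a potentially multiplicative curve has a `ℚ₂`-root) — outside Iwasawa's one-prime lemma. ROW PART: `conjA_two_<L>'` = Coates–Sujatha's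
statement (A) at `p = 2` for the census cubic model `y² = x³ + a₂x² + a₄x + a₆` of the Cremona class (a-invariants of addL2x GEN 13's `nst_census-j313647.tsv`),
PROVED OUTRIGHT: field identification `ℚ(β) = ℚ(θ)` (`β` = a root of the curve's cubic in the power basis of `θ` and back, exact linear algebra in
`ℚ[X]/(g)`) + cruxlead-19573-w2's door `TotallyComplexMu.conjA_two_cubicModel_of_classicalMu_of_discr_neg` (kernel Lim 3.5@2 + `ℓ = 2` ascent with real
places). Certificates found by the seat's exact-arithmetic search (`work/tools/cubiccert.py`, `fieldiso.py`) and CHECKED HERE by the kernel; eng-2's census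
(CERT-ADD-POTMULT-FUKUDA269-E2: ORDER pair at layer 0, bnfcertify) agrees (`μ₂ = λ₂ = 0`). This is statement (A), NOT BSD: BSD₂ for these curves is not proved
by any of this; C4″ and its (I1M′) binder stay research-open (Iwasawa's `μ₂ = 0` for non-Galois cubic fields is open in general); nothing booked; no row of
22618 changes tier (pen RC-490 (4)). Pattern and toolkit: k4-w1 GEN 5–8 (`…MuTwoKernelRows{A,B}`, `…AscentStampsA`, `…ChevalleyOneBitDoor`,
`…ClassNumberOddCriterion`, `…TwoLayerDoor{,EvenIndex}`, `…ExplicitMinkowski`, `…CubicDiscriminant`; all kernel).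

References: [CoatesSujatha2005] Conj. A, Thm. 3.4; [Iwasawa1973MuInvariants] Thm. 2/3; [Fukuda1994] Thm. 1 (1); [Lang1990] Ch. 13 §4 Lemma 4.1;
[Washington1997] §13.1; [Marcus1977] Ch. 5 Thm. 35–37; [Cohen1993] §6.3; [Lim2017FineSelmer] §3; cell files `eng2/fukuda269/{TABLE,LAYERS}-ADD-POTMULT-FUKUDA269-E2-v1.tsv`,
`addL2x/gen13/kit-nst/nst_census-j313647.tsv`, `k4w3/gen9/census/POTMULT-IRR-CONJA2-CENSUS-22618-k4w3-GEN9.tsv`.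
-/

set_option autoImplicit false
-- sibling precedent (`…MuTwoKernelRowsA.lean`): the directory name repeats the summit name
set_option linter.dupNamespace false

noncomputable section

open scoped Classical IntermediateField NumberField Real nonZeroDivisors

namespace Summit.BirchSwinnertonDyer.BirchSwinnertonDyer.Theorems.AddKatoTwo

open WeierstrassCurve Field Polynomial IsDedekindDomain NumberField Matrix Literature.NumberTheory.EllipticCurves
  Literature.NumberTheory.GaloisRepresentations
  Literature.NumberTheory.IwasawaTheory
  Summit.BirchSwinnertonDyer.BirchSwinnertonDyer.Theorems.SteinbergFibreAtTwo
  Summit.BirchSwinnertonDyer.BirchSwinnertonDyer.Theorems.AlignedTransportAtTwoTorsionPointField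
  Summit.BirchSwinnertonDyer.BirchSwinnertonDyer.Theses.ByReductionTypeAtTwo

/-! ## The cubic field of discriminant `-59` (`X³ + (0)X² + (2)X + (-1)`; C4″ rows 365328bn1) -/

/-- `X³ + (0)X² + (2)X + (-1)` is irreducible over `ℚ` (no root mod `3`). -/
theorem irreducible_cubic_d59n : Irreducible (Cubic.toPoly ⟨1, ((0 : ℤ) : ℚ), ((2 : ℤ) : ℚ), ((-1 : ℤ) : ℚ)⟩) :=
  haveI : Fact (Nat.Prime 3) := ⟨by norm_num⟩
  irreducible_cubic_of_no_root_zmod 3 (by decide)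

section Certd59n

variable (K : Type) [Field K] [NumberField K]

/-- **`h` is ODD for every cubic number field whose integers contain a root `θ` of `X³ + (0)X² + (2)X + (-1)`** (`|disc| = 59`,
`M_K < 3`): a norm certificate — for every prime `ℓ < 3` and every root `a` of the cubic mod `ℓ` a generator `x + yθ + zθ² ∈ ℤ[θ]` of norm `±ℓ`
of the ideal `I ∋ ℓ, θ − a` of norm `ℓ` (`ℓ = 2`: `a = 1` ↦ `-1 + (0)θ + (-1)θ²`); found by exact search (seat tool `work/tools/cubiccert.py`) and CHECKED HERE by the
kernel (`pow_three_eq_span_of_cert`, `Or.inl` = the ideal itself is principal). eng-2's GRH-free PARI value: `h = 1`. KERNEL.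
[cite: Marcus1977, Ch. 5 Thm. 35–37 and Cor. 2] [cite: Cohen1993, §6.3] -/
theorem odd_classNumber_of_root_d59n (h3 : Module.finrank ℚ K = 3) (b : 𝓞 K)
    (hb : b ^ 3 + (0 : ℤ) * b ^ 2 + (2 : ℤ) * b + (-1 : ℤ) = 0) : Odd (NumberField.classNumber K) := by
  have hirr := irreducible_cubic_d59n
  have hd : |NumberField.discr K| ≤ (59 : ℕ) :=
    (abs_discr_le_abs_cubic_discr K h3 b hirr hb).trans (by simp only [Cubic.discr]; norm_num)
  refine odd_classNumber_of_cubeCertificate K h3 (B := 3)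
    (minkowskiBound_lt_of_sqrt_le K h3 hd (s := 7.69)
      ((Real.sqrt_le_sqrt (by norm_num : ((59 : ℕ) : ℝ) ≤ (7.69 : ℝ) ^ 2)).trans (Real.sqrt_sq (by norm_num)).le)
      (by norm_num)) ?_
  intro ℓ hℓB hℓ J hJ
  interval_cases ℓ <;> norm_num at hℓ
  · -- `ℓ = 2`: roots [1]
    refine pow_three_eq_span_of_cert K h3 b hirr hb (by norm_num) (fun a ha hdvd => ?_) hJ
    interval_cases a <;> norm_num at hdvd
    · exact Or.inl ⟨(-1), (0), (-1), 1, by norm_num, by norm_num, ⟨_, by rw [Nat.cast_one, one_mul]⟩, by norm_num⟩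

end Certd59n

/-- **Iwasawa's `μ₂ = 0` for the cubic field of discriminant `-59`** (`ℚ(θ)`, `θ³ + (0)θ² + (2)θ + (-1) = 0`; TWO primes above `2`,
`2` unramified (odd discriminant); `h` odd), KERNEL — every cyclotomic `ℤ₂`-extension of `ℚ(θ)` has `μ = 0` (growth form; indeed `e_n = 0` for all `n`).
Chevalley's door at `2` (k4-w1 `layerOneBit_of_chevalleyCert`): the unit `ε = 0 + (-1)θ + (0)θ²` (`ε³ + (0)ε² + (2)ε + (1) = 0`) has
`ε ≡ 5 (mod 8)` under `θ ↦ z₂ ≡ 3` (`8 ∣ g(3)`, `g'(3)` odd), so `(ε, 2)_𝔭 = −1`: a non-norm from `ℚ(θ, √2)`, whence `e₁ = 0`; `≤ 2` primes above `2` by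
`4 ∤ g(0)`, `4 ∤ g(1)`; `e₀ = 0` by `odd_classNumber_of_root_d59n`; `n₀ = 0` because the discriminant is odd (`classicalMuVanishes_two_adjoin_of_odd_cubic_discr`); Fukuda 1994 Thm. 1 (1) (`_holds`).
The (I1M′) input of GEN 9's door for the C4″ rows 365328bn1. [cite: Fukuda1994, Thm. 1 (1), p. 264] [cite: Lang1990, Ch. 13 §4, Lemma 4.1]
[cite: Washington1997, §13.1] [cite: Greenberg2001IwasawaPastPresent, §4 (Iwasawa's μ-conjecture)] -/
theorem classicalMu_two_cubicField_d59n {θ : AlgebraicClosure ℚ} (hθ : aeval θ (Cubic.toPoly ⟨1, ((0 : ℤ) : ℚ), ((2 : ℤ) : ℚ), ((-1 : ℤ) : ℚ)⟩) = 0) :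
    haveI : FiniteDimensional ℚ (IntermediateField.adjoin ℚ {θ}) :=
      IntermediateField.adjoin.finiteDimensional ((AlgebraicClosure.isAlgebraic ℚ).isAlgebraic θ).isIntegral
    haveI : NumberField (IntermediateField.adjoin ℚ {θ}) := NumberField.mk
    ∀ κL : ZpExtension (IntermediateField.adjoin ℚ {θ}) 2, κL.IsCyclotomic → ClassicalMuVanishes κL := by
  intro κL hκL
  have hθ' : θ ^ 3 + (0 : AlgebraicClosure ℚ) * θ ^ 2 + (2 : AlgebraicClosure ℚ) * θ + (-1 : AlgebraicClosure ℚ) = 0 := by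
    have := hθ
    simp only [Cubic.toPoly, map_one, one_mul, aeval_add, aeval_mul, aeval_C, aeval_X_pow, aeval_X,
      eq_ratCast, Rat.cast_intCast] at this
    push_cast at this
    linear_combination this
  have he : aeval (algebraMap ℚ (AlgebraicClosure ℚ) (((0 : ℤ) : ℚ) / ((1 : ℤ) : ℚ)) +
      algebraMap ℚ (AlgebraicClosure ℚ) (((-1 : ℤ) : ℚ) / ((1 : ℤ) : ℚ)) * θ +
      algebraMap ℚ (AlgebraicClosure ℚ) (((0 : ℤ) : ℚ) / ((1 : ℤ) : ℚ)) * θ ^ 2)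
      (Cubic.toPoly ⟨1, ((0 : ℤ) : ℚ), ((2 : ℤ) : ℚ), ((1 : ℤ) : ℚ)⟩) = 0 := by
    simp only [Cubic.toPoly, map_one, one_mul, aeval_add, aeval_mul, aeval_C, aeval_X_pow, aeval_X, eq_ratCast,
      Rat.cast_intCast, Rat.cast_div]
    push_cast
    linear_combination ((-1 : AlgebraicClosure ℚ)) * hθ'
  have hh := not_two_dvd_card_classGroup_adjoin_of_forall_cubicField_odd irreducible_cubic_d59n (odd_classNumber_of_root_d59n) hθ
  have h1 := layerOneBit_of_chevalleyCert irreducible_cubic_d59n hθ hh ⟨0, by norm_num⟩ ⟨0, by norm_num⟩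
      (0) (-1) (0) (1) (0) (2) (1) (by norm_num) he (3) (1) (by norm_num) (by norm_num) (by decide) (by decide)
  exact classicalMuVanishes_two_adjoin_of_odd_cubic_discr irreducible_cubic_d59n (by simp only [Cubic.discr]; norm_num) hθ hh κL hκL
    (h1 κL hκL)

/-! ### Row `365328bn1` (cubic field `d = -59`) -/

/-- The census cubic model of the C4″ row `365328bn1` (`y² = x³ + (0)x² + (-744184371)x + (-7813919468302)`, addL2x GEN 13 `nst_census` a-invariants) is an elliptic curve. -/
theorem isElliptic_365328bn1' : (⟨0, ((0 : ℤ) : ℚ), 0, ((-744184371 : ℤ) : ℚ), ((-7813919468302 : ℤ) : ℚ)⟩ : WeierstrassCurve ℚ).IsElliptic :=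
  isElliptic_cubicModel _ _ _ (by simp only [Cubic.discr]; norm_num)

/-- **UNCONDITIONAL (A)₂ for the C4″ census curve `365328bn1` — ZERO hypotheses, ZERO named facts** (additive potentially multiplicative at `2`,
irreducible `E[2]`, `Δ < 0`; `2`-torsion cubic field `ℚ(θ)`, `θ³ + (0)θ² + (2)θ + (-1) = 0`, `d = -59`, `p q, f(q)=2`, `h` odd). Coates–Sujatha's
statement (A) at `p = 2` for the cubic model `y² = x³ + (0)x² + (-744184371)x + (-7813919468302)`: for every cyclotomic `ℤ₂`-extension of `ℚ` the dual fine Selmer group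
over `ℚ_∞` is finitely generated over `ℤ₂` (`∃ γ D` currency). KERNEL: `classicalMu_two_cubicField_d59n` above (μ₂(ℚ(θ)_cyc) = 0 for the field of `X³ + (0)X² + (2)X + (-1)`) ⟹ cruxlead-19573-w2's `ℓ = 2` ascent to the totally complex
`ℚ(E[2]) = ℚ(θ, √d)` and kernel Lim 3.5@2 (`TotallyComplexMu.conjA_two_cubicModel_of_classicalMu_of_discr_neg`); the root `β = x(T)` of the curve's cubic is
`24076 + (8187)θ + (18057)θ²` and `ℚ(β) = ℚ(θ)`. This discharges the (I1M′) input of this row (GEN 9 `hAnaMI_negDisc_of_cubicFieldMu`) in the kernel;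
it is statement (A), NOT BSD: BSD₂ for `365328bn1` is NOT proved by this. [cite: CoatesSujatha2005, Conj. A and Thm. 3.4]
[cite: Iwasawa1973MuInvariants, Thm. 2 and Thm. 3] [cite: Fukuda1994, Thm. 1 (1), p. 264] [cite: Lang1990, Ch. 13 §4, Lemma 4.1] -/
theorem conjA_two_365328bn1' (κ : ZpExtension ℚ 2) (hκ : κ.IsCyclotomic) :
    haveI := isElliptic_365328bn1'
    ∃ (γ : absoluteGaloisGroup ℚ) (D : (⟨0, ((0 : ℤ) : ℚ), 0, ((-744184371 : ℤ) : ℚ), ((-7813919468302 : ℤ) : ℚ)⟩ : WeierstrassCurve ℚ).FineSelmerDualData κ γ),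
      Module.Finite ℤ_[2] (RestrictScalars ℤ_[2] (IwasawaAlgebra 2) D.X) := by
  haveI := isElliptic_365328bn1'
  obtain ⟨θ, hθ⟩ : ∃ θ : AlgebraicClosure ℚ, aeval θ (Cubic.toPoly ⟨1, ((0 : ℤ) : ℚ), ((2 : ℤ) : ℚ), ((-1 : ℤ) : ℚ)⟩) = 0 :=
    IsAlgClosed.exists_aeval_eq_zero _ _ (by rw [Cubic.degree_of_a_ne_zero one_ne_zero]; norm_num)
  have hθ' : θ ^ 3 + (0 : AlgebraicClosure ℚ) * θ ^ 2 + (2 : AlgebraicClosure ℚ) * θ + (-1 : AlgebraicClosure ℚ) = 0 := by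
    have := hθ
    simp only [Cubic.toPoly, map_one, one_mul, aeval_add, aeval_mul, aeval_C, aeval_X_pow, aeval_X,
      eq_ratCast, Rat.cast_intCast] at this
    push_cast at this
    linear_combination this
  set β : AlgebraicClosure ℚ := algebraMap ℚ (AlgebraicClosure ℚ) (24076 : ℚ) +
      algebraMap ℚ (AlgebraicClosure ℚ) (8187 : ℚ) * θ + algebraMap ℚ (AlgebraicClosure ℚ) (18057 : ℚ) * θ ^ 2 with hβdef
  have hβ : aeval β (Cubic.toPoly ⟨1, ((0 : ℤ) : ℚ), ((-744184371 : ℤ) : ℚ), ((-7813919468302 : ℤ) : ℚ)⟩) = 0 := by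
    simp only [Cubic.toPoly, map_one, one_mul, aeval_add, aeval_mul, aeval_C, aeval_X_pow, aeval_X, eq_ratCast,
      Rat.cast_intCast]
    rw [hβdef]
    simp only [eq_ratCast]
    push_cast
    linear_combination ((11775158073522 : AlgebraicClosure ℚ) + (15406077200085 : AlgebraicClosure ℚ) * θ + (8008242970689 : AlgebraicClosure ℚ) * θ ^ 2 + (5887579631193 : AlgebraicClosure ℚ) * θ ^ 3) * hθ'
  have hadj : IntermediateField.adjoin ℚ {β} = IntermediateField.adjoin ℚ {θ} := by
    apply le_antisymm
    · rw [IntermediateField.adjoin_simple_le_iff, hβdef]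
      have hθmem := IntermediateField.mem_adjoin_simple_self ℚ θ
      exact add_mem (add_mem (algebraMap_mem _ _) (mul_mem (algebraMap_mem _ _) hθmem))
        (mul_mem (algebraMap_mem _ _) (pow_mem hθmem 2))
    · rw [IntermediateField.adjoin_simple_le_iff]
      have hθeq : θ = algebraMap ℚ (AlgebraicClosure ℚ) (-1493081909683/198144 : ℚ) +
          algebraMap ℚ (AlgebraicClosure ℚ) (-94799045/396288 : ℚ) * β +
          algebraMap ℚ (AlgebraicClosure ℚ) (6019/396288 : ℚ) * β ^ 2 := by
        rw [hβdef]; simp only [eq_ratCast]; push_cast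
        linear_combination (((-98867197169 : AlgebraicClosure ℚ) / 22016) + ((-218058504859 : AlgebraicClosure ℚ) / 44032) * θ) * hθ'
      rw [hθeq]
      have hβmem := IntermediateField.mem_adjoin_simple_self ℚ β
      exact add_mem (add_mem (algebraMap_mem _ _) (mul_mem (algebraMap_mem _ _) hβmem))
        (mul_mem (algebraMap_mem _ _) (pow_mem hβmem 2))
  have h3 : Module.finrank ℚ (IntermediateField.adjoin ℚ {β}) = 3 := by
    rw [hadj]; exact finrank_adjoin_eq_three_of_irreducible irreducible_cubic_d59n hθ
  exact TotallyComplexMu.conjA_two_cubicModel_of_classicalMu_of_discr_neg (0) (-744184371) (-7813919468302)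
    (irreducible_cubic_of_finrank_adjoin_eq_three hβ h3) (by simp only [Cubic.discr]; norm_num) hβ
    (by rw [hadj]; exact classicalMu_two_cubicField_d59n hθ) κ hκ

/-! ## The cubic field of discriminant `-200` (`X³ + (-1)X² + (2)X + (2)`; C4″ rows 305200by1, 59200dz1) -/

/-- `X³ + (-1)X² + (2)X + (2)` is irreducible over `ℚ` (no root mod `3`). -/
theorem irreducible_cubic_d200n : Irreducible (Cubic.toPoly ⟨1, ((-1 : ℤ) : ℚ), ((2 : ℤ) : ℚ), ((2 : ℤ) : ℚ)⟩) :=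
  haveI : Fact (Nat.Prime 3) := ⟨by norm_num⟩
  irreducible_cubic_of_no_root_zmod 3 (by decide)

section Certd200n

variable (K : Type) [Field K] [NumberField K]

/-- **`h` is ODD for every cubic number field whose integers contain a root `θ` of `X³ + (-1)X² + (2)X + (2)`** (`|disc| = 200`,
`M_K < 5`): a norm certificate — for every prime `ℓ < 5` and every root `a` of the cubic mod `ℓ` a generator `x + yθ + zθ² ∈ ℤ[θ]` of norm `±ℓ`
of the ideal `I ∋ ℓ, θ − a` of norm `ℓ` (`ℓ = 2`: `a = 0` ↦ `0 + (-1)θ + (0)θ²`, `a = 1` ↦ `-1 + (-1)θ + (0)θ²`; `ℓ = 3`: no root); found by exact search (seat tool `work/tools/cubiccert.py`) and CHECKED HERE by the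
kernel (`pow_three_eq_span_of_cert`, `Or.inl` = the ideal itself is principal). eng-2's GRH-free PARI value: `h = 1`. KERNEL.
[cite: Marcus1977, Ch. 5 Thm. 35–37 and Cor. 2] [cite: Cohen1993, §6.3] -/
theorem odd_classNumber_of_root_d200n (h3 : Module.finrank ℚ K = 3) (b : 𝓞 K)
    (hb : b ^ 3 + (-1 : ℤ) * b ^ 2 + (2 : ℤ) * b + (2 : ℤ) = 0) : Odd (NumberField.classNumber K) := by
  have hirr := irreducible_cubic_d200n
  have hd : |NumberField.discr K| ≤ (200 : ℕ) :=
    (abs_discr_le_abs_cubic_discr K h3 b hirr hb).trans (by simp only [Cubic.discr]; norm_num)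
  refine odd_classNumber_of_cubeCertificate K h3 (B := 5)
    (minkowskiBound_lt_of_sqrt_le K h3 hd (s := 14.15)
      ((Real.sqrt_le_sqrt (by norm_num : ((200 : ℕ) : ℝ) ≤ (14.15 : ℝ) ^ 2)).trans (Real.sqrt_sq (by norm_num)).le)
      (by norm_num)) ?_
  intro ℓ hℓB hℓ J hJ
  interval_cases ℓ <;> norm_num at hℓ
  · -- `ℓ = 2`: roots [0, 1]
    refine pow_three_eq_span_of_cert K h3 b hirr hb (by norm_num) (fun a ha hdvd => ?_) hJ
    interval_cases a <;> norm_num at hdvd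
    · exact Or.inl ⟨(0), (-1), (0), 1, by norm_num, by norm_num, ⟨_, by rw [Nat.cast_one, one_mul]⟩, by norm_num⟩
    · exact Or.inl ⟨(-1), (-1), (0), 1, by norm_num, by norm_num, ⟨_, by rw [Nat.cast_one, one_mul]⟩, by norm_num⟩
  · -- `ℓ = 3`: roots []
    refine pow_three_eq_span_of_cert K h3 b hirr hb (by norm_num) (fun a ha hdvd => ?_) hJ
    interval_cases a <;> norm_num at hdvd

end Certd200n

/-- **Iwasawa's `μ₂ = 0` for the cubic field of discriminant `-200`** (`ℚ(θ)`, `θ³ + (-1)θ² + (2)θ + (2) = 0`; TWO primes above `2`,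
`2 = 𝔭𝔮²`; `h` odd), KERNEL — every cyclotomic `ℤ₂`-extension of `ℚ(θ)` has `μ = 0` (growth form; indeed `e_n = 0` for all `n`).
Chevalley's door at `2` (k4-w1 `layerOneBit_of_chevalleyCert`): the unit `ε = -1 + (-1)θ + (1)θ²` (`ε³ + (7)ε² + (13)ε + (-1) = 0`) has
`ε ≡ 3 (mod 8)` under `θ ↦ z₂ ≡ 5` (`8 ∣ g(5)`, `g'(5)` odd), so `(ε, 2)_𝔭 = −1`: a non-norm from `ℚ(θ, √2)`, whence `e₁ = 0`; `≤ 2` primes above `2` by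
`4 ∤ g(0)`, `4 ∤ g(3)`; `e₀ = 0` by `odd_classNumber_of_root_d200n`; `n₀ = 0` by an even-index certificate `u, v, m, m'` (`u² − 2v² = 4m`, `m² = 2m'`, `8 ∤ N(2 − m'³)`; `classicalMuVanishes_two_adjoin_of_evenIndexCertificate`); Fukuda 1994 Thm. 1 (1) (`_holds`).
The (I1M′) input of GEN 9's door for the C4″ rows 305200by1, 59200dz1. [cite: Fukuda1994, Thm. 1 (1), p. 264] [cite: Lang1990, Ch. 13 §4, Lemma 4.1]
[cite: Washington1997, §13.1] [cite: Greenberg2001IwasawaPastPresent, §4 (Iwasawa's μ-conjecture)] -/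
theorem classicalMu_two_cubicField_d200n {θ : AlgebraicClosure ℚ} (hθ : aeval θ (Cubic.toPoly ⟨1, ((-1 : ℤ) : ℚ), ((2 : ℤ) : ℚ), ((2 : ℤ) : ℚ)⟩) = 0) :
    haveI : FiniteDimensional ℚ (IntermediateField.adjoin ℚ {θ}) :=
      IntermediateField.adjoin.finiteDimensional ((AlgebraicClosure.isAlgebraic ℚ).isAlgebraic θ).isIntegral
    haveI : NumberField (IntermediateField.adjoin ℚ {θ}) := NumberField.mk
    ∀ κL : ZpExtension (IntermediateField.adjoin ℚ {θ}) 2, κL.IsCyclotomic → ClassicalMuVanishes κL := by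
  intro κL hκL
  have hθ' : θ ^ 3 + (-1 : AlgebraicClosure ℚ) * θ ^ 2 + (2 : AlgebraicClosure ℚ) * θ + (2 : AlgebraicClosure ℚ) = 0 := by
    have := hθ
    simp only [Cubic.toPoly, map_one, one_mul, aeval_add, aeval_mul, aeval_C, aeval_X_pow, aeval_X,
      eq_ratCast, Rat.cast_intCast] at this
    push_cast at this
    linear_combination this
  have he : aeval (algebraMap ℚ (AlgebraicClosure ℚ) (((-1 : ℤ) : ℚ) / ((1 : ℤ) : ℚ)) +
      algebraMap ℚ (AlgebraicClosure ℚ) (((-1 : ℤ) : ℚ) / ((1 : ℤ) : ℚ)) * θ +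
      algebraMap ℚ (AlgebraicClosure ℚ) (((1 : ℤ) : ℚ) / ((1 : ℤ) : ℚ)) * θ ^ 2)
      (Cubic.toPoly ⟨1, ((7 : ℤ) : ℚ), ((13 : ℤ) : ℚ), ((-1 : ℤ) : ℚ)⟩) = 0 := by
    simp only [Cubic.toPoly, map_one, one_mul, aeval_add, aeval_mul, aeval_C, aeval_X_pow, aeval_X, eq_ratCast,
      Rat.cast_intCast, Rat.cast_div]
    push_cast
    linear_combination ((-4 : AlgebraicClosure ℚ) + (3 : AlgebraicClosure ℚ) * θ + (-2 : AlgebraicClosure ℚ) * θ ^ 2 + (1 : AlgebraicClosure ℚ) * θ ^ 3) * hθ'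
  have hh := not_two_dvd_card_classGroup_adjoin_of_forall_cubicField_odd irreducible_cubic_d200n (odd_classNumber_of_root_d200n) hθ
  have h1 := layerOneBit_of_chevalleyCert irreducible_cubic_d200n hθ hh ⟨0, by norm_num⟩ ⟨1, by norm_num⟩
      (-1) (-1) (1) (1) (7) (13) (-1) (by norm_num) he (5) (1) (by norm_num) (by norm_num) (by decide) (by decide)
  have hirr := irreducible_cubic_d200n
  haveI : FiniteDimensional ℚ (IntermediateField.adjoin ℚ {θ}) :=
    IntermediateField.adjoin.finiteDimensional ((AlgebraicClosure.isAlgebraic ℚ).isAlgebraic θ).isIntegral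
  haveI : NumberField (IntermediateField.adjoin ℚ {θ}) := NumberField.mk
  obtain ⟨B, -, hB⟩ := exists_ringOfIntegers_cubic_root (p := -1) (q := 2) (r := 2) hθ
  have h3 := finrank_adjoin_eq_three_of_irreducible hirr hθ
  refine classicalMuVanishes_two_adjoin_of_evenIndexCertificate (p := -1) (q := 2) (r := 2) hirr hθ
    (((0 : ℤ) : 𝓞 (IntermediateField.adjoin ℚ {θ})) + ((-1 : ℤ) : 𝓞 (IntermediateField.adjoin ℚ {θ})) * B + ((1 : ℤ) : 𝓞 (IntermediateField.adjoin ℚ {θ})) * B ^ 2) (((-1 : ℤ) : 𝓞 (IntermediateField.adjoin ℚ {θ})) + ((-1 : ℤ) : 𝓞 (IntermediateField.adjoin ℚ {θ})) * B + ((0 : ℤ) : 𝓞 (IntermediateField.adjoin ℚ {θ})) * B ^ 2) (((0 : ℤ) : 𝓞 (IntermediateField.adjoin ℚ {θ})) + ((-1 : ℤ) : 𝓞 (IntermediateField.adjoin ℚ {θ})) * B + ((-1 : ℤ) : 𝓞 (IntermediateField.adjoin ℚ {θ})) * B ^ 2) (((-3 : ℤ) : 𝓞 (IntermediateField.adjoin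 ℚ {θ})) + ((-4 : ℤ) : 𝓞 (IntermediateField.adjoin ℚ {θ})) * B + ((1 : ℤ) : 𝓞 (IntermediateField.adjoin ℚ {θ})) * B ^ 2) ?_ ?_ ?_
    hh κL hκL (h1 κL hκL)
  · push_cast; linear_combination (((-1 : ℤ) : 𝓞 (IntermediateField.adjoin ℚ {θ})) + ((1 : ℤ) : 𝓞 (IntermediateField.adjoin ℚ {θ})) * B + ((0 : ℤ) : 𝓞 (IntermediateField.adjoin ℚ {θ})) * B ^ 2) * hB
  · push_cast; linear_combination (((3 : ℤ) : 𝓞 (IntermediateField.adjoin ℚ {θ})) + ((1 : ℤ) : 𝓞 (IntermediateField.adjoin ℚ {θ})) * B + ((0 : ℤ) : 𝓞 (IntermediateField.adjoin ℚ {θ})) * B ^ 2) * hB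
  · have hz : (2 : 𝓞 (IntermediateField.adjoin ℚ {θ})) - (((-3 : ℤ) : 𝓞 (IntermediateField.adjoin ℚ {θ})) + ((-4 : ℤ) : 𝓞 (IntermediateField.adjoin ℚ {θ})) * B + ((1 : ℤ) : 𝓞 (IntermediateField.adjoin ℚ {θ})) * B ^ 2) ^ 3 =
        ((137 : ℤ) : 𝓞 (IntermediateField.adjoin ℚ {θ})) + (268 : ℤ) * B + (93 : ℤ) * B ^ 2 := by
      push_cast; linear_combination (((-54 : ℤ) : 𝓞 (IntermediateField.adjoin ℚ {θ})) + ((-26 : ℤ) : 𝓞 (IntermediateField.adjoin ℚ {θ})) * B + ((11 : ℤ) : 𝓞 (IntermediateField.adjoin ℚ {θ})) * B ^ 2 + ((-1 : ℤ) : 𝓞 (IntermediateField.adjoin ℚ {θ})) * B ^ 3 + ((0 : ℤ) : 𝓞 (IntermediateField.adjoin ℚ {θ})) * B ^ 4) * hB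
    rw [hz]
    exact not_eight_dvd_norm_coords _ h3 B hirr hB (137) (268) (93) (N := 929450)
      (by simp only [Matrix.one_fin_three, Matrix.det_fin_three, Matrix.add_apply, Matrix.smul_apply, sq, Matrix.mul_apply,
        Fin.sum_univ_three, Matrix.of_apply, Matrix.cons_val', Matrix.cons_val_zero, Matrix.cons_val_one, Matrix.cons_val_two,
        Matrix.head_cons, Matrix.tail_cons, Matrix.empty_val', Matrix.cons_val_fin_one, smul_eq_mul]; norm_num) (by norm_num)

/-! ### Row `305200by1` (cubic field `d = -200`) -/

/-- The census cubic model of the C4″ row `305200by1` (`y² = x³ + (1)x² + (-49896208)x + (-135676498412)`, addL2x GEN 13 `nst_census` a-invariants) is an elliptic curve. -/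
theorem isElliptic_305200by1' : (⟨0, ((1 : ℤ) : ℚ), 0, ((-49896208 : ℤ) : ℚ), ((-135676498412 : ℤ) : ℚ)⟩ : WeierstrassCurve ℚ).IsElliptic :=
  isElliptic_cubicModel _ _ _ (by simp only [Cubic.discr]; norm_num)

/-- **UNCONDITIONAL (A)₂ for the C4″ census curve `305200by1` — ZERO hypotheses, ZERO named facts** (additive potentially multiplicative at `2`,
irreducible `E[2]`, `Δ < 0`; `2`-torsion cubic field `ℚ(θ)`, `θ³ + (-1)θ² + (2)θ + (2) = 0`, `d = -200`, `p q^2, F_q=Q2(sqrt-2)`, `h` odd). Coates–Sujatha's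
statement (A) at `p = 2` for the cubic model `y² = x³ + (1)x² + (-49896208)x + (-135676498412)`: for every cyclotomic `ℤ₂`-extension of `ℚ` the dual fine Selmer group
over `ℚ_∞` is finitely generated over `ℤ₂` (`∃ γ D` currency). KERNEL: `classicalMu_two_cubicField_d200n` above (μ₂(ℚ(θ)_cyc) = 0 for the field of `X³ + (-1)X² + (2)X + (2)`) ⟹ cruxlead-19573-w2's `ℓ = 2` ascent to the totally complex
`ℚ(E[2]) = ℚ(θ, √d)` and kernel Lim 3.5@2 (`TotallyComplexMu.conjA_two_cubicModel_of_classicalMu_of_discr_neg`); the root `β = x(T)` of the curve's cubic is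
`4148 + (-4420)θ + (2675)θ²` and `ℚ(β) = ℚ(θ)`. This discharges the (I1M′) input of this row (GEN 9 `hAnaMI_negDisc_of_cubicFieldMu`) in the kernel;
it is statement (A), NOT BSD: BSD₂ for `305200by1` is NOT proved by this. [cite: CoatesSujatha2005, Conj. A and Thm. 3.4]
[cite: Iwasawa1973MuInvariants, Thm. 2 and Thm. 3] [cite: Fukuda1994, Thm. 1 (1), p. 264] [cite: Lang1990, Ch. 13 §4, Lemma 4.1] -/
theorem conjA_two_305200by1' (κ : ZpExtension ℚ 2) (hκ : κ.IsCyclotomic) :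
    haveI := isElliptic_305200by1'
    ∃ (γ : absoluteGaloisGroup ℚ) (D : (⟨0, ((1 : ℤ) : ℚ), 0, ((-49896208 : ℤ) : ℚ), ((-135676498412 : ℤ) : ℚ)⟩ : WeierstrassCurve ℚ).FineSelmerDualData κ γ),
      Module.Finite ℤ_[2] (RestrictScalars ℤ_[2] (IwasawaAlgebra 2) D.X) := by
  haveI := isElliptic_305200by1'
  obtain ⟨θ, hθ⟩ : ∃ θ : AlgebraicClosure ℚ, aeval θ (Cubic.toPoly ⟨1, ((-1 : ℤ) : ℚ), ((2 : ℤ) : ℚ), ((2 : ℤ) : ℚ)⟩) = 0 :=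
    IsAlgClosed.exists_aeval_eq_zero _ _ (by rw [Cubic.degree_of_a_ne_zero one_ne_zero]; norm_num)
  have hθ' : θ ^ 3 + (-1 : AlgebraicClosure ℚ) * θ ^ 2 + (2 : AlgebraicClosure ℚ) * θ + (2 : AlgebraicClosure ℚ) = 0 := by
    have := hθ
    simp only [Cubic.toPoly, map_one, one_mul, aeval_add, aeval_mul, aeval_C, aeval_X_pow, aeval_X,
      eq_ratCast, Rat.cast_intCast] at this
    push_cast at this
    linear_combination this
  set β : AlgebraicClosure ℚ := algebraMap ℚ (AlgebraicClosure ℚ) (4148 : ℚ) +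
      algebraMap ℚ (AlgebraicClosure ℚ) (-4420 : ℚ) * θ + algebraMap ℚ (AlgebraicClosure ℚ) (2675 : ℚ) * θ ^ 2 with hβdef
  have hβ : aeval β (Cubic.toPoly ⟨1, ((1 : ℤ) : ℚ), ((-49896208 : ℤ) : ℚ), ((-135676498412 : ℤ) : ℚ)⟩) = 0 := by
    simp only [Cubic.toPoly, map_one, one_mul, aeval_add, aeval_mul, aeval_C, aeval_X_pow, aeval_X, eq_ratCast,
      Rat.cast_intCast]
    rw [hβdef]
    simp only [eq_ratCast]
    push_cast
    linear_combination ((-135629336750 : AlgebraicClosure ℚ) + (131806478750 : AlgebraicClosure ℚ) * θ + (-75742290625 : AlgebraicClosure ℚ) * θ ^ 2 + (19141296875 : AlgebraicClosure ℚ) * θ ^ 3) * hθ'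
  have hadj : IntermediateField.adjoin ℚ {β} = IntermediateField.adjoin ℚ {θ} := by
    apply le_antisymm
    · rw [IntermediateField.adjoin_simple_le_iff, hβdef]
      have hθmem := IntermediateField.mem_adjoin_simple_self ℚ θ
      exact add_mem (add_mem (algebraMap_mem _ _) (mul_mem (algebraMap_mem _ _) hθmem))
        (mul_mem (algebraMap_mem _ _) (pow_mem hθmem 2))
    · rw [IntermediateField.adjoin_simple_le_iff]
      have hθeq : θ = algebraMap ℚ (AlgebraicClosure ℚ) (-254101041/427280 : ℚ) +
          algebraMap ℚ (AlgebraicClosure ℚ) (-437023/5981920 : ℚ) * β +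
          algebraMap ℚ (AlgebraicClosure ℚ) (107/5981920 : ℚ) * β ^ 2 := by
        rw [hβdef]; simp only [eq_ratCast]; push_cast
        linear_combination (((352915425 : AlgebraicClosure ℚ) / 1196384) + ((-153130375 : AlgebraicClosure ℚ) / 1196384) * θ) * hθ'
      rw [hθeq]
      have hβmem := IntermediateField.mem_adjoin_simple_self ℚ β
      exact add_mem (add_mem (algebraMap_mem _ _) (mul_mem (algebraMap_mem _ _) hβmem))
        (mul_mem (algebraMap_mem _ _) (pow_mem hβmem 2))
  have h3 : Module.finrank ℚ (IntermediateField.adjoin ℚ {β}) = 3 := by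
    rw [hadj]; exact finrank_adjoin_eq_three_of_irreducible irreducible_cubic_d200n hθ
  exact TotallyComplexMu.conjA_two_cubicModel_of_classicalMu_of_discr_neg (1) (-49896208) (-135676498412)
    (irreducible_cubic_of_finrank_adjoin_eq_three hβ h3) (by simp only [Cubic.discr]; norm_num) hβ
    (by rw [hadj]; exact classicalMu_two_cubicField_d200n hθ) κ hκ

/-! ### Row `59200dz1` (cubic field `d = -200`) -/

/-- The census cubic model of the C4″ row `59200dz1` (`y² = x³ + (0)x² + (-4967500)x + (-4569670000)`, addL2x GEN 13 `nst_census` a-invariants) is an elliptic curve. -/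
theorem isElliptic_59200dz1' : (⟨0, ((0 : ℤ) : ℚ), 0, ((-4967500 : ℤ) : ℚ), ((-4569670000 : ℤ) : ℚ)⟩ : WeierstrassCurve ℚ).IsElliptic :=
  isElliptic_cubicModel _ _ _ (by simp only [Cubic.discr]; norm_num)

/-- **UNCONDITIONAL (A)₂ for the C4″ census curve `59200dz1` — ZERO hypotheses, ZERO named facts** (additive potentially multiplicative at `2`,
irreducible `E[2]`, `Δ < 0`; `2`-torsion cubic field `ℚ(θ)`, `θ³ + (-1)θ² + (2)θ + (2) = 0`, `d = -200`, `p q^2, F_q=Q2(sqrt-2)`, `h` odd). Coates–Sujatha's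
statement (A) at `p = 2` for the cubic model `y² = x³ + (0)x² + (-4967500)x + (-4569670000)`: for every cyclotomic `ℤ₂`-extension of `ℚ` the dual fine Selmer group
over `ℚ_∞` is finitely generated over `ℤ₂` (`∃ γ D` currency). KERNEL: `classicalMu_two_cubicField_d200n` above (μ₂(ℚ(θ)_cyc) = 0 for the field of `X³ + (-1)X² + (2)X + (2)`) ⟹ cruxlead-19573-w2's `ℓ = 2` ascent to the totally complex
`ℚ(E[2]) = ℚ(θ, √d)` and kernel Lim 3.5@2 (`TotallyComplexMu.conjA_two_cubicModel_of_classicalMu_of_discr_neg`); the root `β = x(T)` of the curve's cubic is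
`1350 + (-1320)θ + (910)θ²` and `ℚ(β) = ℚ(θ)`. This discharges the (I1M′) input of this row (GEN 9 `hAnaMI_negDisc_of_cubicFieldMu`) in the kernel;
it is statement (A), NOT BSD: BSD₂ for `59200dz1` is NOT proved by this. [cite: CoatesSujatha2005, Conj. A and Thm. 3.4]
[cite: Iwasawa1973MuInvariants, Thm. 2 and Thm. 3] [cite: Fukuda1994, Thm. 1 (1), p. 264] [cite: Lang1990, Ch. 13 §4, Lemma 4.1] -/
theorem conjA_two_59200dz1' (κ : ZpExtension ℚ 2) (hκ : κ.IsCyclotomic) :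
    haveI := isElliptic_59200dz1'
    ∃ (γ : absoluteGaloisGroup ℚ) (D : (⟨0, ((0 : ℤ) : ℚ), 0, ((-4967500 : ℤ) : ℚ), ((-4569670000 : ℤ) : ℚ)⟩ : WeierstrassCurve ℚ).FineSelmerDualData κ γ),
      Module.Finite ℤ_[2] (RestrictScalars ℤ_[2] (IwasawaAlgebra 2) D.X) := by
  haveI := isElliptic_59200dz1'
  obtain ⟨θ, hθ⟩ : ∃ θ : AlgebraicClosure ℚ, aeval θ (Cubic.toPoly ⟨1, ((-1 : ℤ) : ℚ), ((2 : ℤ) : ℚ), ((2 : ℤ) : ℚ)⟩) = 0 :=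
    IsAlgClosed.exists_aeval_eq_zero _ _ (by rw [Cubic.degree_of_a_ne_zero one_ne_zero]; norm_num)
  have hθ' : θ ^ 3 + (-1 : AlgebraicClosure ℚ) * θ ^ 2 + (2 : AlgebraicClosure ℚ) * θ + (2 : AlgebraicClosure ℚ) = 0 := by
    have := hθ
    simp only [Cubic.toPoly, map_one, one_mul, aeval_add, aeval_mul, aeval_C, aeval_X_pow, aeval_X,
      eq_ratCast, Rat.cast_intCast] at this
    push_cast at this
    linear_combination this
  set β : AlgebraicClosure ℚ := algebraMap ℚ (AlgebraicClosure ℚ) (1350 : ℚ) +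
      algebraMap ℚ (AlgebraicClosure ℚ) (-1320 : ℚ) * θ + algebraMap ℚ (AlgebraicClosure ℚ) (910 : ℚ) * θ ^ 2 with hβdef
  have hβ : aeval β (Cubic.toPoly ⟨1, ((0 : ℤ) : ℚ), ((-4967500 : ℤ) : ℚ), ((-4569670000 : ℤ) : ℚ)⟩) = 0 := by
    simp only [Cubic.toPoly, map_one, one_mul, aeval_add, aeval_mul, aeval_C, aeval_X_pow, aeval_X, eq_ratCast,
      Rat.cast_intCast]
    rw [hβdef]
    simp only [eq_ratCast]
    push_cast
    linear_combination ((-4407710000 : AlgebraicClosure ℚ) + (4077710000 : AlgebraicClosure ℚ) * θ + (-2525705000 : AlgebraicClosure ℚ) * θ ^ 2 + (753571000 : AlgebraicClosure ℚ) * θ ^ 3) * hθ'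
  have hadj : IntermediateField.adjoin ℚ {β} = IntermediateField.adjoin ℚ {θ} := by
    apply le_antisymm
    · rw [IntermediateField.adjoin_simple_le_iff, hβdef]
      have hθmem := IntermediateField.mem_adjoin_simple_self ℚ θ
      exact add_mem (add_mem (algebraMap_mem _ _) (mul_mem (algebraMap_mem _ _) hθmem))
        (mul_mem (algebraMap_mem _ _) (pow_mem hθmem 2))
    · rw [IntermediateField.adjoin_simple_le_iff]
      have hθeq : θ = algebraMap ℚ (AlgebraicClosure ℚ) (1607843/303104 : ℚ) +
          algebraMap ℚ (AlgebraicClosure ℚ) (9689/6062080 : ℚ) * β +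
          algebraMap ℚ (AlgebraicClosure ℚ) (-91/60620800 : ℚ) * β ^ 2 := by
        rw [hβdef]; simp only [eq_ratCast]; push_cast
        linear_combination (((-1432613 : AlgebraicClosure ℚ) / 606208) + ((753571 : AlgebraicClosure ℚ) / 606208) * θ) * hθ'
      rw [hθeq]
      have hβmem := IntermediateField.mem_adjoin_simple_self ℚ β
      exact add_mem (add_mem (algebraMap_mem _ _) (mul_mem (algebraMap_mem _ _) hβmem))
        (mul_mem (algebraMap_mem _ _) (pow_mem hβmem 2))
  have h3 : Module.finrank ℚ (IntermediateField.adjoin ℚ {β}) = 3 := by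
    rw [hadj]; exact finrank_adjoin_eq_three_of_irreducible irreducible_cubic_d200n hθ
  exact TotallyComplexMu.conjA_two_cubicModel_of_classicalMu_of_discr_neg (0) (-4967500) (-4569670000)
    (irreducible_cubic_of_finrank_adjoin_eq_three hβ h3) (by simp only [Cubic.discr]; norm_num) hβ
    (by rw [hadj]; exact classicalMu_two_cubicField_d200n hθ) κ hκ
end Summit.BirchSwinnertonDyer.BirchSwinnertonDyer.Theorems.AddKatoTwo

end
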